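import Literature.LinearAlgebra.Matrix.PfaffianDeterminant
import HarnessLib

/-!
# The adjugate of an alternating matrix of odd size is the Gram square of its Pfaffian vector

For an alternating `(m+1) × (m+1)` matrix `A` (`Aᵀ = −A`, zero diagonal) with `m` even, over a
commutative ring in which `2` is a unit,

  `adj(A) = z zᵀ`,  `z_k = (−1)^k · pf(A_{k̂k̂})`

(`pfVec`; `A_{k̂k̂}` = `A` with row and column `k` deleted, an alternating matrix of even size `m`).
This is the classical companion of Cayley's `det = pf²` (`det_eq_pfaffian_sq`, this directory): it
is exactly the statement behind Landsberg–Manivel–Ressayre's description of their boundary form,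
"`P_Λ(M) = det_n(A,…,A,S) = Σ_{i,j} s_{ij} Pf_i(A) Pf_j(A)`" for `M = A + S` skew + symmetric and `n`
odd (CMH 88 (2013) §3.5, p. 480) — `tr(adj(A) S) = Σ s_{ij} z_i z_j` for every symmetric `S` is
equivalent to `adj(A) = z zᵀ`, both sides being symmetric.

Proof (bordering): for the alternating matrix `Ã = [[0, xᵀ], [−x, A]]` of even size `m+2`
(`border x A`), the defining Laplace expansion of the Pfaffian along row `0` gives
`pf(Ã) = z · x` (`pfaffian_border`), two Laplace expansions of the determinant give
`det(Ã) = xᵀ adj(A) x` (`det_border`, any square `A`), and Cayley's theorem `det Ã = pf(Ã)²`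
identifies the quadratic forms of the symmetric matrices `adj(A)` and `z zᵀ`; polarisation
(`2` a unit) finishes (`adjugate_eq_vecMulVec_pfVec`). Also recorded: `A · z = 0` for such `A`
over a domain (`mulVec_pfVec_eq_zero`).

Theorems only plus the two plumbing definitions `pfVec`, `border`; no named facts. Written for the
val-lit cell (LMR 2013 Prop. 3.5.2, dual variety of `Z(P_Λ)`), usable independently.

References: A. Cayley, J. reine angew. Math. 38 (1849) 93–96; J. M. Landsberg, L. Manivel,
N. Ressayre, *Hypersurfaces with degenerate duals and the geometric complexity theory program*,
Comment. Math. Helv. 88 (2013) 469–484, §3.5. [cite: LandsbergManivelRessayre2013, §3.5 (p. 480)]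
-/

namespace Literature.LinearAlgebra.Matrix

open Finset
open _root_.Matrix

variable {R : Type*} [CommRing R] {m : ℕ}

/-- The **Pfaffian vector** `z_k = (−1)^k · pf(A_{k̂k̂})` of signed principal sub-Pfaffians of an
`(m+1) × (m+1)` matrix (LMR's `Pf_i(A)`, "the Pfaffian … of the skew-symmetric matrix … obtained by
eliminating the `i`-th [row and column]", §3.5 p. 480, up to the sign `(−1)^i`).
[cite: LandsbergManivelRessayre2013, §3.5 (p. 480)] -/
def pfVec (A : Matrix (Fin (m + 1)) (Fin (m + 1)) R) : Fin (m + 1) → R :=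
  fun k => (-1) ^ (k : ℕ) * pfaffian (A.submatrix k.succAbove k.succAbove)

/-- Unfolding of `pfVec`. [cite: LandsbergManivelRessayre2013, §3.5 (p. 480)] -/
theorem pfVec_apply (A : Matrix (Fin (m + 1)) (Fin (m + 1)) R) (k : Fin (m + 1)) :
    pfVec A k = (-1) ^ (k : ℕ) * pfaffian (A.submatrix k.succAbove k.succAbove) := rfl

/-- The **bordered matrix** `[[0, xᵀ], [−x, A]]` of size `m + 2` (plumbing for the bordering proof).
[folklore] -/
def border (x : Fin (m + 1) → R) (A : Matrix (Fin (m + 1)) (Fin (m + 1)) R) :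
    Matrix (Fin (m + 2)) (Fin (m + 2)) R :=
  Matrix.of (Fin.cons (Fin.cons 0 x) fun a => Fin.cons (-x a) (A a))

/-- Corner entry of the bordered matrix. [folklore] -/
@[simp] private theorem border_zero_zero (x : Fin (m + 1) → R) (A : Matrix (Fin (m + 1)) (Fin (m + 1)) R) :
    border x A 0 0 = 0 := by
  simp [border]

/-- Row `0` of the bordered matrix is `x`. [folklore] -/
@[simp] private theorem border_zero_succ (x : Fin (m + 1) → R) (A : Matrix (Fin (m + 1)) (Fin (m + 1)) R)
    (b : Fin (m + 1)) : border x A 0 b.succ = x b := by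
  simp [border]

/-- Column `0` of the bordered matrix is `−x`. [folklore] -/
@[simp] private theorem border_succ_zero (x : Fin (m + 1) → R) (A : Matrix (Fin (m + 1)) (Fin (m + 1)) R)
    (a : Fin (m + 1)) : border x A a.succ 0 = -x a := by
  simp [border]

/-- The inner block of the bordered matrix is `A`. [folklore] -/
@[simp] private theorem border_succ_succ (x : Fin (m + 1) → R) (A : Matrix (Fin (m + 1)) (Fin (m + 1)) R)
    (a b : Fin (m + 1)) : border x A a.succ b.succ = A a b := by
  simp [border]

/-- **`pf([[0, xᵀ], [−x, A]]) = z · x`**: the defining Laplace expansion of the Pfaffian along row `0`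
(Kustin–Ulrich (1.18)) applied to the bordered matrix. [cite: LandsbergManivelRessayre2013, §3.5 (p. 480)] -/
theorem pfaffian_border (x : Fin (m + 1) → R) (A : Matrix (Fin (m + 1)) (Fin (m + 1)) R) :
    pfaffian (border x A) = pfVec A ⬝ᵥ x := by
  rw [pfaffian_fin_add_two, dotProduct]
  refine Finset.sum_congr rfl fun j _ => ?_
  have hminor : pfMinor (border x A) j = A.submatrix j.succAbove j.succAbove := by
    ext a b
    simp [pfMinor_apply]
  rw [hminor, border_zero_succ, pfVec_apply]
  ring

/-- **`det([[0, xᵀ], [−x, A]]) = xᵀ adj(A) x`** for every square `A` (two Laplace expansions: along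
row `0`, then along column `0` of each minor; the cofactors of `A` appear as
`Matrix.adjugate_fin_succ_eq_det_submatrix`) — Cauchy's formula for the determinant of a bordered
matrix, `det [[A, x], [yᵀ, a]] = a·det A − yᵀ adj(A) x`, at `a = 0`, `y = −x`.
[cite: HornJohnson2013, §0.8.5 (Cauchy's formula for the determinant of a bordered matrix)] -/
theorem det_border (x : Fin (m + 1) → R) (A : Matrix (Fin (m + 1)) (Fin (m + 1)) R) :
    (border x A).det = x ⬝ᵥ (A.adjugate *ᵥ x) := by
  rw [det_succ_row_zero, Fin.sum_univ_succ, border_zero_zero, mul_zero, zero_mul, zero_add]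
  -- the minor complementary to `(0, l+1)`: column `0` is `−x`, the rest is `A` minus column `l`
  have hcol : ∀ l : Fin (m + 1),
      ((border x A).submatrix Fin.succ (Fin.succ l).succAbove).det =
        ∑ k : Fin (m + 1), (-1) ^ (k : ℕ) * (-x k) * (A.submatrix k.succAbove l.succAbove).det := by
    intro l
    rw [det_succ_column_zero]
    refine Finset.sum_congr rfl fun k _ => ?_
    have h0 : (border x A).submatrix Fin.succ (Fin.succ l).succAbove k 0 = -x k := by
      simp [Matrix.submatrix_apply]
    have h1 : ((border x A).submatrix Fin.succ (Fin.succ l).succAbove).submatrix k.succAbove Fin.succ =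
        A.submatrix k.succAbove l.succAbove := by
      ext a b
      simp [Matrix.submatrix_apply, Fin.succ_succAbove_succ]
    rw [h0, h1]
  simp_rw [hcol]
  simp only [dotProduct, mulVec, border_zero_succ, Finset.mul_sum]
  refine Finset.sum_congr rfl fun l _ => Finset.sum_congr rfl fun k _ => ?_
  rw [adjugate_fin_succ_eq_det_submatrix, Fin.val_succ, pow_succ, pow_add]
  ring

/-- The bordered matrix of an alternating matrix is alternating. [folklore] -/
private theorem border_transpose {x : Fin (m + 1) → R} {A : Matrix (Fin (m + 1)) (Fin (m + 1)) R}
    (hA : Aᵀ = -A) : (border x A)ᵀ = -border x A := by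
  ext i j
  refine Fin.cases ?_ (fun a => ?_) i <;> refine Fin.cases ?_ (fun b => ?_) j
  · simp
  · simp
  · simp
  · have h := congrFun (congrFun hA a) b
    simp only [transpose_apply] at h
    simp [h]

/-- … with zero diagonal. [folklore] -/
private theorem border_apply_self {x : Fin (m + 1) → R} {A : Matrix (Fin (m + 1)) (Fin (m + 1)) R}
    (hd : ∀ i, A i i = 0) (i : Fin (m + 2)) : border x A i i = 0 := by
  refine Fin.cases ?_ (fun a => ?_) i
  · simp
  · simp [hd a]

/-- The quadratic form of the adjugate of an alternating matrix is the square of the Pfaffian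
linear form: `xᵀ adj(A) x = (z · x)²` (Cayley's theorem on the bordered matrix). This is LMR's
"`det_n(A,…,A,S) = Σ s_{ij} Pf_i(A) Pf_j(A)`" read on rank-one symmetric `S = x xᵀ`.
[cite: LandsbergManivelRessayre2013, §3.5 (p. 480)] -/
theorem dotProduct_adjugate_mulVec_eq_sq {x : Fin (m + 1) → R}
    {A : Matrix (Fin (m + 1)) (Fin (m + 1)) R} (hA : Aᵀ = -A) (hd : ∀ i, A i i = 0) :
    x ⬝ᵥ (A.adjugate *ᵥ x) = (pfVec A ⬝ᵥ x) ^ 2 := by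
  rw [← det_border, det_eq_pfaffian_sq _ (border_transpose hA) (border_apply_self hd), pfaffian_border]

/-- For `m` even (odd size `m + 1`) the adjugate of an alternating matrix is symmetric:
`adj(A)ᵀ = adj(Aᵀ) = adj(−A) = (−1)^m adj(A)` (`adj(Aᵀ) = adj(A)ᵀ`, `adj(cA) = c^{n−1} adj(A)`).
[cite: HornJohnson2013, §0.8.5 (the adjugate)] -/
theorem adjugate_transpose_of_alternating (hm : Even m) {A : Matrix (Fin (m + 1)) (Fin (m + 1)) R}
    (hA : Aᵀ = -A) : (A.adjugate)ᵀ = A.adjugate := by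
  rw [adjugate_transpose, hA, ← neg_one_smul R A, adjugate_smul, Fintype.card_fin,
    Nat.add_sub_cancel, Even.neg_one_pow hm, one_smul]

/-- Polarisation: a symmetric matrix whose quadratic form vanishes identically is zero, provided
`2` is a unit. [folklore] -/
private theorem eq_zero_of_isSymm_of_dotProduct_mulVec_eq_zero {ι : Type*} [Fintype ι] [DecidableEq ι]
    (h2 : IsUnit (2 : R)) {F : Matrix ι ι R} (hF : Fᵀ = F)
    (hq : ∀ x : ι → R, x ⬝ᵥ (F *ᵥ x) = 0) : F = 0 := by
  ext k l
  have hkk : F k k = 0 := by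
    have := hq (Pi.single k 1)
    rwa [mulVec_single_one, single_one_dotProduct] at this
  have hll : F l l = 0 := by
    have := hq (Pi.single l 1)
    rwa [mulVec_single_one, single_one_dotProduct] at this
  have hlk : F l k = F k l := by
    have := congrFun (congrFun hF k) l
    rwa [transpose_apply] at this
  have hsum := hq (Pi.single k 1 + Pi.single l 1)
  rw [mulVec_add, add_dotProduct, dotProduct_add, dotProduct_add, mulVec_single_one,
    mulVec_single_one, single_one_dotProduct, single_one_dotProduct, single_one_dotProduct,
    single_one_dotProduct] at hsum
  simp only [col_apply] at hsum hkk hll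
  rw [hkk, hll, hlk, zero_add, add_zero, ← two_mul] at hsum
  rw [Matrix.zero_apply]
  exact (h2.mul_right_eq_zero).mp hsum

/-- **The adjugate of an alternating matrix of odd size `m + 1` is `z zᵀ`**, `z` the vector of
signed principal sub-Pfaffians (`pfVec`), over any commutative ring in which `2` is a unit:
`adj(A)_{kl} = (−1)^{k+l} pf(A_{k̂k̂}) pf(A_{l̂l̂})`. Equivalently (LMR 2013 §3.5, p. 480):
`det_n(A,…,A,S) ∝ tr(adj(A)·S) = Σ_{i,j} s_{ij} Pf_i(A) Pf_j(A)` for all symmetric `S`.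
[cite: LandsbergManivelRessayre2013, §3.5 (p. 480)] -/
theorem adjugate_eq_vecMulVec_pfVec (hm : Even m) (h2 : IsUnit (2 : R))
    {A : Matrix (Fin (m + 1)) (Fin (m + 1)) R} (hA : Aᵀ = -A) (hd : ∀ i, A i i = 0) :
    A.adjugate = vecMulVec (pfVec A) (pfVec A) := by
  rw [← sub_eq_zero]
  refine eq_zero_of_isSymm_of_dotProduct_mulVec_eq_zero h2 ?_ fun x => ?_
  · rw [transpose_sub, adjugate_transpose_of_alternating hm hA, transpose_vecMulVec]
  · rw [sub_mulVec, dotProduct_sub, dotProduct_adjugate_mulVec_eq_sq hA hd, vecMulVec_mulVec,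
      dotProduct_smul, MulOpposite.smul_eq_mul_unop, MulOpposite.unop_op, dotProduct_comm x, sq,
      sub_self]

/-- For such `A` over a domain, **`A · z = 0`**: from `A · adj(A) = det(A) · 1 = 0` (Cayley: the
determinant of an alternating matrix of odd size vanishes) and `adj(A) = z zᵀ` — the Pfaffian vector
spans the kernel of a corank-one skew form (the vector `v` of LMR's "`v² ⊕ v ∧ w`", Prop. 3.5.2).
[cite: LandsbergManivelRessayre2013, §3.5 and Proposition 3.5.2 (pp. 480–481)] -/
theorem mulVec_pfVec_eq_zero [IsDomain R] (hm : Even m) (h2 : IsUnit (2 : R))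
    {A : Matrix (Fin (m + 1)) (Fin (m + 1)) R} (hA : Aᵀ = -A) (hd : ∀ i, A i i = 0) :
    A *ᵥ pfVec A = 0 := by
  have hodd : Odd (m + 1) := hm.add_one
  have hdet : A.det = 0 := det_eq_zero_of_transpose_eq_neg_of_odd hodd A hA hd
  have hmul : A * vecMulVec (pfVec A) (pfVec A) = 0 := by
    rw [← adjugate_eq_vecMulVec_pfVec hm h2 hA hd, mul_adjugate, hdet, zero_smul]
  by_cases hz : pfVec A = 0
  · rw [hz, mulVec_zero]
  · obtain ⟨l, hl⟩ := Function.ne_iff.mp hz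
    ext k
    have h := congrFun (congrFun hmul k) l
    rw [mul_vecMulVec, Matrix.zero_apply, vecMulVec_apply] at h
    rcases mul_eq_zero.mp h with h | h
    · rw [h, Pi.zero_apply]
    · exact absurd h hl

end Literature.LinearAlgebra.Matrix
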